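import Literature.Geometry.Riemannian.TwoConvexSchoenfliesProofs
import HarnessLib

/-!
# The link map of a transversal field on a sphere is a diffeomorphism (`k ≥ 2`)

Topic `Literature/Topology/FourManifolds`; input of the codimension `q = k + 1 ≥ 3` step of the
smoothing of PD homeomorphisms (Munkres, Ann. of Math. 72 (1960), §§4–5; Campbell–D'Onofrio–Vítek,
J. Geom. Anal. (2026), Lemma 3.4, step "projection to the sphere is injective").

Let `Ψ : ℝᵏ⁺¹ → ℝᵏ⁺¹` be `C^∞`, nowhere zero on the unit sphere `𝕊ᵏ`, with injective derivative
`DΨ(y)` at every `y ∈ 𝕊ᵏ`, and **radially transversal**: whenever `DΨ(y) v = Ψ(y)` one has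
`⟪v, y⟫ > 0` (the vector field `Ψ` crosses its own first-order cone outwards; for a map
homogeneous of degree one this is Euler's identity `DΨ(y) y = Ψ y`, and the condition is open
under `C¹`-small perturbation — it is the pointwise "Euler defect" condition of the smoothing
induction).  Then the **link map** `θ ↦ Ψ θ / ‖Ψ θ‖` is a diffeomorphism of `𝕊ᵏ` for `k ≥ 2`
(`exists_diffeomorph_sphere_linkMap`): its differential is injective — if
`d(z/‖z‖)(DΨ v) = 0` then `DΨ v = c Ψ`, and `c ≠ 0` would give `⟪c⁻¹ v, y⟫ > 0` for the tangent
vector `v ⊥ y` — so it is a local diffeomorphism `𝕊ᵏ → 𝕊ᵏ`, hence a diffeomorphism, `𝕊ᵏ` being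
compact, connected and simply connected for `k ≥ 2`.  This is the tree's engine
`Literature.Geometry.Riemannian.exists_diffeomorph_sphere_of_normalize` (Huisken–Sinestrari's
"well known result") applied to the inclusion `𝕊ᵏ ⊆ ℝᵏ⁺¹`; the present file only isolates the
transversality bookkeeping.  For `k = 1` (circle links, codimension two) the statement is false
without a degree hypothesis and is treated separately.  Everything here is proved; no definitions,
no named facts.

## References

* J. R. Munkres, *Obstructions to the smoothing of piecewise-differentiable homeomorphisms*, Ann.
  of Math. (2) 72 (1960), 521–554. [Munkres1960]
* D. Campbell, L. D'Onofrio, T. Vítek, *Diffeomorphic approximation of piecewise affine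
  homeomorphisms*, J. Geom. Anal. 36 (2026), Lemma 3.4. [CampbellDonofrioVitek2026]
-/

noncomputable section

open Set Function Metric Module
open scoped Manifold ContDiff Topology RealInnerProductSpace

namespace Literature.Topology.FourManifolds

variable {k : ℕ}

/-- **Radial transversality gives the kernel condition of the Gauss-map engine.** Let
`Ψ : ℝᵏ⁺¹ → ℝᵏ⁺¹` be differentiable at a point `y` of the unit sphere with injective derivative
there, and radially transversal at `y` (`DΨ(y) v = Ψ y ⟹ ⟪v, y⟫ > 0`). If a tangent vector
`w ⊥ y` (`⟪y, w⟫ = 0`) has `DΨ(y) w ∈ ℝ Ψ(y)` then `w = 0`. [folklore] -/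
theorem eq_zero_of_fderiv_mem_span_of_transversal
    {Ψ : EuclideanSpace ℝ (Fin (k + 1)) → EuclideanSpace ℝ (Fin (k + 1))}
    {y : EuclideanSpace ℝ (Fin (k + 1))} (hinj : Injective (fderiv ℝ Ψ y))
    (htr : ∀ v, fderiv ℝ Ψ y v = Ψ y → 0 < ⟪v, y⟫)
    {w : EuclideanSpace ℝ (Fin (k + 1))} (hw : ⟪y, w⟫ = 0)
    (hspan : ∃ c : ℝ, fderiv ℝ Ψ y w = c • Ψ y) : w = 0 := by
  obtain ⟨c, hc⟩ := hspan
  by_cases hc0 : c = 0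
  · rw [hc0, zero_smul] at hc
    exact (injective_iff_map_eq_zero _).1 hinj w hc
  · have h1 : fderiv ℝ Ψ y (c⁻¹ • w) = Ψ y := by
      rw [map_smul, hc, smul_smul, inv_mul_cancel₀ hc0, one_smul]
    have h2 := htr _ h1
    rw [real_inner_smul_left, real_inner_comm, hw, mul_zero] at h2
    exact absurd h2 (lt_irrefl 0)

/-- **The link map of a radially transversal field is a diffeomorphism of `𝕊ᵏ`, `k ≥ 2`.** Let
`Ψ : ℝᵏ⁺¹ → ℝᵏ⁺¹` be `C^∞`, nowhere zero on the unit sphere, with injective derivative at every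
point of the sphere and radially transversal there (`DΨ(y) v = Ψ y ⟹ ⟪v, y⟫ > 0`). Then there is a
diffeomorphism `φ` of `𝕊ᵏ` with `φ θ = Ψ θ / ‖Ψ θ‖` for all `θ`.  (Local diffeomorphism by the
injectivity of the differential; global by compactness, connectedness and simple connectivity of
`𝕊ᵏ`, `k ≥ 2` — the tree's `exists_diffeomorph_sphere_of_normalize`.)  Munkres (1960), §4 (the link
of a simplex under a PD homeomorphism); Campbell–D'Onofrio–Vítek (2026), Lemma 3.4, Step 1.
[cite: CampbellDonofrioVitek2026, Lemma 3.4 (Step 1)] -/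
theorem exists_diffeomorph_sphere_linkMap (hk : 2 ≤ k)
    {Ψ : EuclideanSpace ℝ (Fin (k + 1)) → EuclideanSpace ℝ (Fin (k + 1))} (hΨ : ContDiff ℝ ∞ Ψ)
    (hΨ0 : ∀ y : EuclideanSpace ℝ (Fin (k + 1)), ‖y‖ = 1 → Ψ y ≠ 0)
    (hinj : ∀ y : EuclideanSpace ℝ (Fin (k + 1)), ‖y‖ = 1 → Injective (fderiv ℝ Ψ y))
    (htr : ∀ y : EuclideanSpace ℝ (Fin (k + 1)), ‖y‖ = 1 →
      ∀ v, fderiv ℝ Ψ y v = Ψ y → 0 < ⟪v, y⟫) :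
    ∃ φ : (sphere (0 : EuclideanSpace ℝ (Fin (k + 1))) 1) ≃ₘ⟮𝓡 k, 𝓡 k⟯
        (sphere (0 : EuclideanSpace ℝ (Fin (k + 1))) 1),
      ∀ θ, (φ θ : EuclideanSpace ℝ (Fin (k + 1))) = ‖Ψ θ‖⁻¹ • Ψ θ := by
  haveI hfact : Fact (finrank ℝ (EuclideanSpace ℝ (Fin (k + 1))) = k + 1) :=
    ⟨finrank_euclideanSpace_fin⟩
  have hnorm : ∀ θ : sphere (0 : EuclideanSpace ℝ (Fin (k + 1))) 1,
      ‖(θ : EuclideanSpace ℝ (Fin (k + 1)))‖ = 1 := fun θ => by simp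
  -- the sphere is connected (`k + 1 ≥ 2`)
  haveI : ConnectedSpace (sphere (0 : EuclideanSpace ℝ (Fin (k + 1))) 1) := by
    refine isConnected_iff_connectedSpace.1 (isConnected_sphere ?_ 0 zero_le_one)
    rw [← Module.finrank_eq_rank, finrank_euclideanSpace_fin]
    exact_mod_cast (show 1 < k + 1 by omega)
  -- the inclusion of the sphere is an immersion
  have himm : Manifold.IsImmersion (𝓡 k) 𝓘(ℝ, EuclideanSpace ℝ (Fin (k + 1))) ∞
      (Subtype.val : sphere (0 : EuclideanSpace ℝ (Fin (k + 1))) 1 →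
        EuclideanSpace ℝ (Fin (k + 1))) :=
    isImmersion_of_injective_mfderiv (contMDiff_coe_sphere (n := k)) (by simp)
      fun v => mfderiv_coe_sphere_injective v
  refine Literature.Geometry.Riemannian.exists_diffeomorph_sphere_of_normalize hk himm hΨ
    (fun θ => hΨ0 _ (hnorm θ)) fun θ v hv => ?_
  -- the kernel condition: tangent vectors are orthogonal to the base point
  have hwmem : (mfderiv (𝓡 k) 𝓘(ℝ, EuclideanSpace ℝ (Fin (k + 1)))
      (Subtype.val : sphere (0 : EuclideanSpace ℝ (Fin (k + 1))) 1 → EuclideanSpace ℝ (Fin (k + 1)))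
        θ v : EuclideanSpace ℝ (Fin (k + 1))) ∈ (ℝ ∙ (θ : EuclideanSpace ℝ (Fin (k + 1))))ᗮ := by
    rw [← range_mfderiv_coe_sphere (n := k) θ]
    exact LinearMap.mem_range_self _ v
  exact eq_zero_of_fderiv_mem_span_of_transversal (hinj _ (hnorm θ)) (htr _ (hnorm θ))
    (Submodule.mem_orthogonal_singleton_iff_inner_right.1 hwmem) hv

end Literature.Topology.FourManifolds
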